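import Mathlib
import Literature.Analysis.FluidPDE.TorusABCFlow
import Literature.Analysis.FluidPDE.LinearizedNSTorus
import Summits.NavierStokesRegularity.FluidComputer.AbcForcedSteadyState
import Literature.Analysis.FluidPDE.TorusNonlinearInstability
import HarnessLib

/-!
# The forced ABC flow as a steady Navier–Stokes state, and its Lyapunov instability from a certified unstable eigenvalue (instab g8, cell `ns-blowup`, 2026-08-25)

HONEST FRAMING (human ruling D-0035): nothing here is a claim about Navier–Stokes blow-up.
WHAT THIS IS NOT: not NS blow-up evidence; an INSTABILITY statement about the TRUE forced
Navier–Stokes system near an exact steady state, CONDITIONAL on one printed theorem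
(Friedlander–Pavlović–Shvydkoy 2006, Thm 2.2, the tree's named fact
`Literature.Analysis.FluidPDE.Torus.fps2006_nonlinear_instability_of_eigenvalue`) and on an
unstable eigenvalue of the linearisation (crux X0 of lane N1*: a real class-II eigenvalue of the
linearised operator about the ABC flow at `R = 100`, certified by the cell's skew-cut certificate).
This is rung R-α of `instab/INSTAB-BRIDGE.md` §10: the first arrow after a theorem-grade X0.

* (imported) `AbcForcedSteadyState.isSteadyNSState_abcFlow` — the forced ABC flow is an exact steady
  NS state on `T³` (force `4π²ν·U`, Bernoulli pressure `−|U|²/2`).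
* `isLyapunovUnstable_abcFlow_of_eigenvalue` — FPS06 + an eigenvalue `μ` of the linearisation at
  `U` with `Re μ > 0` ⇒ `U` is Lyapunov unstable for the true forced dynamics
  (`Torus.IsLyapunovUnstableSteadyState`): the cell's X0 (after the unit rescaling
  `(ℝ/2πℤ)³ → T³`: `ν ↦ ν/2π`, `λ ↦ 2πλ`) makes the forced ABC flow at `R = 100` nonlinearly
  unstable — a rung, not a thesis: it implies none of Fefferman (A)/¬(A)/(C)/(D).

Mathlib + Literature only; no new definitions.
-/

noncomputable section

namespace Summit.NavierStokesRegularity.FluidComputer.AbcLyapunovInstability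

open Literature.Analysis.FunctionSpaces Literature.Analysis.FluidPDE Set

/-- **R-α: a certified unstable eigenvalue makes the forced ABC flow Lyapunov unstable for the TRUE
Navier–Stokes dynamics** (conditional on the named fact FPS06 Thm 2.2). If `ν > 0` and the
linearised operator `L(ν, U) w = νΔw − (U·∇)w − (w·∇)U − ∇q` at `U = Torus.abcFlow A B C` has an
eigenvalue `μ` with `Re μ > 0` (`Torus.IsLinNSEigenvalue` — e.g. the cell's X0: a real simple
class-II eigenvalue at `R = 100`), then `U` is a Lyapunov-unstable steady state of the forced system
with force `4π²ν·U`: arbitrarily (kinetic-energy-)small smooth divergence-free perturbations lead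
every global classical solution out of a fixed kinetic-energy ball about `U`. -/
theorem isLyapunovUnstable_abcFlow_of_eigenvalue
    (hFPS : Torus.fps2006_nonlinear_instability_of_eigenvalue)
    {ν : ℝ} (hν : 0 < ν) (A B C : ℝ) {μ : ℂ} (hμ : 0 < μ.re)
    (heig : Torus.IsLinNSEigenvalue ν (Torus.abcFlow A B C) μ) :
    Torus.IsLyapunovUnstableSteadyState ν (fun x => (4 * Real.pi ^ 2 * ν) • Torus.abcFlow A B C x)
      (Torus.abcFlow A B C) :=
  hFPS ν hν _ _ _ (AbcForcedSteadyState.isSteadyNSState_abcFlow ν A B C) ⟨μ, hμ, heig⟩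

end Summit.NavierStokesRegularity.FluidComputer.AbcLyapunovInstability
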